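import Summits.HodgeConjecture.HodgeConjecture.Cruxes.BlochSeedDiscOne.SeedCheckerFrame
import Literature.AlgebraicTopology.SingularHomology.CupProductProofs
import Literature.AlgebraicTopology.SingularHomology.CupProductExteriorH1
import Literature.AlgebraicGeometry.HodgeTheory.CorrespondenceCupProductIdentities
import Literature.AlgebraicGeometry.HodgeTheory.ComplexGysinHodgeType
import Summits.HodgeConjecture.HodgeConjecture.Cruxes.BlochSeedDiscOne.SeedCheckerNewtonClosure
import Summits.HodgeConjecture.HodgeConjecture.Cruxes.BlochSeedDiscOne.SeedCheckerDegree

/-!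
# Seed checker C5–C8 · v39 `SeedCheckerKunnethSquare` — the Künneth-square lemma for `cross`; `eeee ∪ eeee = ēēēē ∪ ēēēē = 0`;
# the Gram form of the frame of record is SCALAR; v23's `FrameGram` of record is ONE top-degree equation; `ω = eeee ∪ ēēēē ≠ 0`

Unit `hsemireg-c5c8-1`, gen 39 (planner, explicit unit MINT A5 «C5–C8 seed checker»; claim-free, kit 0; words by director-hodge only —
none naming c5c8 after R19.520). Token: line stmt-HodgeConjecture-18881 Cruxes/BlochSeedDiscOne/Lines/birth.lean 814a6a70c14e831a
stub_rung_pad4_seedAt.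

HONEST FRAMING. A TYPED, KERNEL-CHECKED FILE — NOT A RUNG. Nothing here is proved toward HC ∕ HC_CM ∕ HC_AV ∕ №4 ∕ 26512 ∕ 18881 ∕ H2;
`stub_rung_pad4_seedAt` is never restated, weakened or used. No candidate (design json, presentation) exists, so nothing is run on one.
Additive: no earlier seed-checker module is edited; imports only BUILT modules (v7.1 `SeedCheckerFrame`, v23 `SeedCheckerNewtonClosure`,
v12 `SeedCheckerDegree`) and Literature; no `instance`, no `notation`, no unsafe option, 0 `sorry`.

WHAT IT CLOSES. g38 §4 LEFTOVER (i): v38 `NewtonKit.frameGram_normalisedFrame_iff` typed v23's kit hypothesis `FrameGram` for the FRAME OF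
RECORD `(r₁, r₂) = (eeee + ēēēē, i(eeee − ēēēē))` (v7.1 `normalisedFrame`) as THREE top-degree identities
`eeee ∪ eeee = 0 ∧ ēēēē ∪ ēēēē = 0 ∧ 2·8!·(eeee ∪ ēēēē) = γ·h⁸` and left the two squares undischarged («needs a Künneth-square lemma for
`cross` not in tree»). Here:

* §39.1 `cup_interchange` — `(x ∪ y) ∪ (x' ∪ y') = (−1)^{|y||x'|}·(x ∪ x') ∪ (y ∪ y')` for `singularCohomology` (associativity
  `cupProduct_assoc` + graded commutativity `cupProduct_gradedComm_holds`, Hatcher Thm. 3.11), and for pull-backs along two maps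
  `cup_mapCup_mapCup` ∕ `cupMap_interchange(_of_even)` (naturality `cupProduct_map`, Hatcher Prop. 3.10).
* §39.2 on the curve `E₀`: `x⁺ ∪ x⁺ = x⁻ ∪ x⁻ = 0` (`cup_self_deg_one`), `x⁻ ∪ x⁺ = −x⁺ ∪ x⁻`, `xx := x⁺ ∪ x⁻ = 2i·(v ∪ ψ₀^*v)` (`xx_eq`); on the
  Weil surface `S = E₀ × E₀`: **`e ∪ e = ē ∪ ē = 0`**, `e ∪ ē = ē ∪ e = ss := pr₁^*xx ∪ pr₂^*xx`.
* §39.3 **`cross_cup_cross`** (THE LEMMA): `cross b c ∪ cross b' c' = pr₁^*(b ∪ b') ∪ pr₂^*(c ∪ c')` on `B × S` (all degrees even — no sign);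
  the tower squares **`ee² = ēē² = eee² = ēēē² = eeee² = ēēēē² = 0`** (`eTwo_cup_eTwo` … `eeee_cup_eeee`, `eeeeBar_cup_eeeeBar`), `ēēēē ∪ eeee =
  eeee ∪ ēēēē =: ω` (`omega`), and the bilinear expansion `cup_planeComb : (a·eeee + b·ēēēē) ∪ (c·eeee + d·ēēēē) = (ad + bc)·ω`.
* §39.4 THE GRAM FORM OF THE FRAME OF RECORD IS SCALAR: `r₁ ∪ r₁ = r₂ ∪ r₂ = 2ω`, `r₁ ∪ r₂ = r₂ ∪ r₁ = 0`,
  **`w_μ ∪ w_μ' = (μ·μ̄' + μ̄·μ')·ω`** (`wOf_cup_wOf`; the trace form of `ℚ(i)` on the C0 coordinate `mu`), `w_μ ∪ w_μ = 2N(μ)·ω` (`wOf_cup_self`).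
* §39.5 **`frameGram_normalisedFrame_iff : FrameGram (normalisedFrame …) h γ ↔ 80640·ω = γ·h⁸`** — v38's statement minus its two squares and
  minus its `IsRationalClass h` ∕ `h⁸ ≠ 0` hypotheses; `exists_frameGram_constant` (a constant `c ∈ ℂ` always exists once `h⁸ ≠ 0`, v12),
  `frameGram_normalisedFrame_iff_hDegree : … ↔ γ = 80640·deg_h(ω)` (v12's coordinate), `frameGram_two_iff : FrameGram … 2 ↔ 8!·ω = h⁸`.
* §39.6 UNCONDITIONAL NON-VANISHING (no kit, no polarisation, no `WeilAnisotropic`): `v ∪ ψ₀^*v ≠ 0` (`cup_map_one_ne_zero`: `{v, ψ₀^*v}` is a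
  basis of `H¹(E₀(ℂ); ℂ)` — `linearIndependent_pair_map_one`, `finrank_complexBetti_one` — `v ∪ v = 0`, and the cup pairing of the closed surface
  `E₀(ℂ)` is perfect, `eq_zero_of_forall_cupPairing_eq_zero`), hence `xx ≠ 0`, `ss ≠ 0`, `ee ∪ ēē ≠ 0`, `eee ∪ ēēē ≠ 0`, **`ω ≠ 0`** (Künneth
  injectivity `cupProduct_map_fst_map_snd_ne_zero_of_add_eq` up the nested tower, `omega_eq`), `w_μ ∪ w_μ ≠ 0` for `μ ≠ 0`, and
  `frameGram_gamma_ne_zero : FrameGram (normalisedFrame …) h γ → γ ≠ 0 ∧ h⁸ ≠ 0`.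
* §39.7 `v`-RELATIVITY made quantitative: `ω(v') = r⁸·ω(v)` for the real `r > 0` of v7.1 `exists_letters_eq_smul` (`exists_omega_eq_smul`), and
  `frameGram_rescale : FrameGram(v) γ → (FrameGram(v') γ' ↔ γ' = r⁸·γ)`.

FLAG DELTA (v38 §3, row «`FrameGram` for the frame of record»; nothing in C5–C8 becomes vacuous or implied by C0–C4):
WAS «`eeee² = 0 ∧ ēēēē² = 0 ∧ 2·8!·(eeee ∪ ēēēē) = γ·h⁸`, typed, not discharged». NOW the two squares are THEOREMS and the entire residual
content of v23's `FrameGram K.F h γ` on the cell's own frame is ONE EQUATION `2·8!·ω = γ·h⁸` between two NON-ZERO vectors of the line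
`H¹⁶(S⁴(ℂ); ℂ) = ℂ·h⁸`, i.e. ONE NUMBER `γ(v, h) = 2·8!·deg_h(ω(v))`, which (1) exists in `ℂ` and is `≠ 0` for every balanced `h` with `h⁸ ≠ 0`,
(2) is NOT shown rational here (that is what `FrameGram … γ` with `γ : ℚ` adds), and (3) is `v`-RELATIVE: `γ(v') = r⁸·γ(v)`. So MEMO-06's
«`∫ w_μ² = 2|μ|²`, `γ = 2`» is a NORMALISATION CONVENTION tying the `H¹`-generator `v` to `h` (`8!·ω(v) = h⁸`), not a property of the anchor:
a candidate that names `μ` «in the frame of record» (C0 `mu`) must also pin `v` (equivalently `deg_h ω`), else `γ` — and with it v23's (R4)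
numeric door `P₈ + 18·γ·N(μ) = 0` — is undetermined up to `ℝ_{>0}` (v38's γ-free Gram door `newtonClosedNum_gram_of_realisedBy` is immune).

Sources: Hatcher, Algebraic Topology (2002) §3.2 Prop. 3.10, Thm. 3.11, Thm. 3.16, §3.3 Prop. 3.38 [cite: HatcherAT2002, §3.2 Thm. 3.16];
van Geemen 1994 (Weil classes, the `e ∕ ē` letters) [cite: vanGeemen1994HodgeAV, 4.9–4.11 and proof of Thm. 6.12]; tree: v7.1 `SeedCheckerFrame`
(`cross`, `eeee`, `normalisedFrame`, `exists_letters_eq_smul`), v23 `SeedCheckerNewtonClosure` (`FrameGram`), v12 `SeedCheckerDegree`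
(`exists_eq_smul_hPow8`, `hDegree`), `CupProductProofs` (`cupProduct_gradedComm_holds`), `CupProductExteriorH1` (`cup_self_deg_one`),
`ComplexGysinHodgeType` (`eq_zero_of_forall_cupPairing_eq_zero`), `WeilClassesProductsOfFactors` (`cupProduct_map_fst_map_snd_ne_zero_of_add_eq`),
`WeilSurfaceCMSquare` (`linearIndependent_pair_map_one`).
-/

noncomputable section

set_option linter.dupNamespace false

open CategoryTheory AlgebraicGeometry
open Literature.AlgebraicGeometry Literature.AlgebraicGeometry.Motives Literature.AlgebraicGeometry.HodgeTheory
open Literature.AlgebraicTopology.SingularHomology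

namespace Summit.HodgeConjecture.HodgeConjecture.Cruxes.BlochSeedDiscOne.SeedChecker.KunnethSquare

open Summit.HodgeConjecture.HodgeConjecture.Cruxes.BlochSeedDiscOne.Anchor
open Summit.Ventures.HSemireg Summit.Ventures.HSemireg.Pad4Tower

/-! ## §39.1 Middle-four interchange for the cup product (graded-commutative bookkeeping) -/

section Interchange

variable {R : Type} [CommRing R] {Y : Type} [TopologicalSpace Y]

/-- **middle-four interchange**: `(x ∪ y) ∪ (x' ∪ y') = (−1)^{|y||x'|} (x ∪ x') ∪ (y ∪ y')`
(`cupProduct_assoc` + Hatcher Thm. 3.11, the tree's `cupProduct_gradedComm_holds`). [cite: HatcherAT2002, §3.2 Thm. 3.11] -/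
theorem cup_interchange {a b a' b' n n' N A B : ℕ} (hn : a + b = n) (hn' : a' + b' = n') (hN : n + n' = N)
    (hA : a + a' = A) (hB : b + b' = B) (hAB : A + B = N) (x : singularCohomology R R Y a)
    (y : singularCohomology R R Y b) (x' : singularCohomology R R Y a') (y' : singularCohomology R R Y b') :
    cupProduct hN (cupProduct hn x y) (cupProduct hn' x' y') =
      ((-1 : R) ^ (b * a')) • cupProduct hAB (cupProduct hA x x') (cupProduct hB y y') := by
  rw [cupProduct_assoc hn (rfl : b + n' = b + n') hN (by omega) x y,
    ← cupProduct_assoc (rfl : b + a' = b + a') hn' (by omega : b + a' + b' = b + n') rfl y x' y',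
    cupProduct_gradedComm_holds R Y (rfl : b + a' = b + a') (Nat.add_comm a' b) y x', map_smul, LinearMap.smul_apply,
    map_smul, cupProduct_assoc (Nat.add_comm a' b) hB (by omega : b + a' + b' = b + n') (by omega) x' y y',
    ← cupProduct_assoc hA (by omega : a' + B = b + n') hAB (by omega) x x']

/-- interchange WITHOUT sign when `|y|·|x'|` is even. -/
theorem cup_interchange_of_even {a b a' b' n n' N A B : ℕ} (hn : a + b = n) (hn' : a' + b' = n') (hN : n + n' = N)
    (hA : a + a' = A) (hB : b + b' = B) (hAB : A + B = N) (he : Even (b * a')) (x : singularCohomology R R Y a)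
    (y : singularCohomology R R Y b) (x' : singularCohomology R R Y a') (y' : singularCohomology R R Y b') :
    cupProduct hN (cupProduct hn x y) (cupProduct hn' x' y') =
      cupProduct hAB (cupProduct hA x x') (cupProduct hB y y') := by
  rw [cup_interchange hn hn' hN hA hB hAB, he.neg_one_pow, one_smul]

/-- **product of two exterior products of pull-backs**: `(f^*x ∪ g^*y) ∪ (f^*x' ∪ g^*y') = (−1)^{|y||x'|} f^*(x ∪ x') ∪ g^*(y ∪ y')`
(interchange + naturality `cupProduct_map`, Hatcher Prop. 3.10). [cite: HatcherAT2002, §3.2 Prop. 3.10] -/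
theorem cup_mapCup_mapCup {Y₁ Y₂ : Type} [TopologicalSpace Y₁] [TopologicalSpace Y₂] (f : C(Y, Y₁)) (g : C(Y, Y₂))
    {a b a' b' n n' N A B : ℕ} (hn : a + b = n) (hn' : a' + b' = n') (hN : n + n' = N)
    (hA : a + a' = A) (hB : b + b' = B) (hAB : A + B = N) (x : singularCohomology R R Y₁ a)
    (y : singularCohomology R R Y₂ b) (x' : singularCohomology R R Y₁ a') (y' : singularCohomology R R Y₂ b') :
    cupProduct hN (cupProduct hn (singularCohomology.map R R f a x) (singularCohomology.map R R g b y))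
        (cupProduct hn' (singularCohomology.map R R f a' x') (singularCohomology.map R R g b' y')) =
      ((-1 : R) ^ (b * a')) • cupProduct hAB (singularCohomology.map R R f A (cupProduct hA x x'))
        (singularCohomology.map R R g B (cupProduct hB y y')) := by
  rw [cup_interchange hn hn' hN hA hB hAB, cupProduct_map f hA, cupProduct_map g hB]

/-- the same for the complex Betti cohomology of `ℂ`-schemes: `(f^*x ∪ g^*y) ∪ (f^*x' ∪ g^*y') =
(−1)^{|y||x'|} f^*(x ∪ x') ∪ g^*(y ∪ y')` (`complexBetti.map_cupProduct`). [cite: HatcherAT2002, §3.2 Prop. 3.10] -/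
theorem cupMap_interchange {X X₁ X₂ : SchemeOver ℂ} (f : X ⟶ X₁) (g : X ⟶ X₂)
    {a b a' b' n n' N A B : ℕ} (hn : a + b = n) (hn' : a' + b' = n') (hN : n + n' = N)
    (hA : a + a' = A) (hB : b + b' = B) (hAB : A + B = N) (x : complexBetti X₁ a)
    (y : complexBetti X₂ b) (x' : complexBetti X₁ a') (y' : complexBetti X₂ b') :
    cupProduct hN (cupProduct hn (complexBetti.map f a x) (complexBetti.map g b y))
        (cupProduct hn' (complexBetti.map f a' x') (complexBetti.map g b' y')) =
      ((-1 : ℂ) ^ (b * a')) • cupProduct hAB (complexBetti.map f A (cupProduct hA x x'))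
        (complexBetti.map g B (cupProduct hB y y')) := by
  rw [cup_interchange hn hn' hN hA hB hAB, complexBetti.map_cupProduct f hA, complexBetti.map_cupProduct g hB]

/-- … and without sign for `|y|·|x'|` even. -/
theorem cupMap_interchange_of_even {X X₁ X₂ : SchemeOver ℂ} (f : X ⟶ X₁) (g : X ⟶ X₂)
    {a b a' b' n n' N A B : ℕ} (hn : a + b = n) (hn' : a' + b' = n') (hN : n + n' = N)
    (hA : a + a' = A) (hB : b + b' = B) (hAB : A + B = N) (he : Even (b * a')) (x : complexBetti X₁ a)
    (y : complexBetti X₂ b) (x' : complexBetti X₁ a') (y' : complexBetti X₂ b') :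
    cupProduct hN (cupProduct hn (complexBetti.map f a x) (complexBetti.map g b y))
        (cupProduct hn' (complexBetti.map f a' x') (complexBetti.map g b' y')) =
      cupProduct hAB (complexBetti.map f A (cupProduct hA x x')) (complexBetti.map g B (cupProduct hB y y')) := by
  rw [cupMap_interchange f g hn hn' hN hA hB hAB, he.neg_one_pow, one_smul]

end Interchange

/-! ## §39.2 The letters square to zero: `x^± ∪ x^± = 0`, `e ∪ e = 0`, `ē ∪ ē = 0`; `e ∪ ē = pr₁^*(x⁺x⁻) ∪ pr₂^*(x⁺x⁻)` -/

section Letters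

variable {E₀ : AbelianVariety ℂ} {ψ₀ : E₀ ⟶ E₀}

theorem d1122 : 2 * 1 + 2 * 1 = 2 * 2 := rfl

/-- the top class `x⁺ ∪ x⁻ ∈ H²(E₀(ℂ); ℂ)` of the eigenframe (`= 2i · v ∪ ψ₀^*v`). -/
def xx (ψ₀ : E₀ ⟶ E₀) (v : complexBetti E₀.X 1) : complexBetti E₀.X (2 * 1) :=
  cupProduct one_add_one_eq_two_mul_one (xPlus ψ₀ v) (xMinus ψ₀ v)

theorem xPlus_cup_xPlus (v : complexBetti E₀.X 1) :
    cupProduct one_add_one_eq_two_mul_one (xPlus ψ₀ v) (xPlus ψ₀ v) = 0 :=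
  cup_self_deg_one (xPlus ψ₀ v)

theorem xMinus_cup_xMinus (v : complexBetti E₀.X 1) :
    cupProduct one_add_one_eq_two_mul_one (xMinus ψ₀ v) (xMinus ψ₀ v) = 0 :=
  cup_self_deg_one (xMinus ψ₀ v)

/-- `x⁻ ∪ x⁺ = −(x⁺ ∪ x⁻)`. -/
theorem xMinus_cup_xPlus (v : complexBetti E₀.X 1) :
    cupProduct one_add_one_eq_two_mul_one (xMinus ψ₀ v) (xPlus ψ₀ v) = -xx ψ₀ v := by
  rw [xx, cupProduct_gradedComm_holds ℂ (ComplexPoints E₀.X) one_add_one_eq_two_mul_one one_add_one_eq_two_mul_one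
    (xMinus ψ₀ v) (xPlus ψ₀ v)]
  simp

/-- `x⁺ ∪ x⁻ = 2i·(v ∪ ψ₀^*v)`. -/
theorem xx_eq (v : complexBetti E₀.X 1) :
    xx ψ₀ v = (2 * Complex.I) • cupProduct one_add_one_eq_two_mul_one v (complexBetti.map ψ₀.hom.hom.hom 1 v) := by
  set w : complexBetti E₀.X 1 := complexBetti.map ψ₀.hom.hom.hom 1 v with hw
  have hvv : cupProduct one_add_one_eq_two_mul_one v v = 0 := cup_self_deg_one v
  have hww : cupProduct one_add_one_eq_two_mul_one w w = 0 := cup_self_deg_one w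
  have hwv : cupProduct one_add_one_eq_two_mul_one w v = -cupProduct one_add_one_eq_two_mul_one v w := by
    rw [cupProduct_gradedComm_holds ℂ (ComplexPoints E₀.X) one_add_one_eq_two_mul_one one_add_one_eq_two_mul_one w v]
    simp
  have hP : xPlus ψ₀ v = v - Complex.I • w := rfl
  have hM : xMinus ψ₀ v = v + Complex.I • w := rfl
  rw [xx, hP, hM]
  simp only [map_sub, map_add, map_smul, LinearMap.sub_apply, LinearMap.smul_apply, hvv, hww,
    hwv, smul_zero, smul_neg]
  module

/-- **`e ∪ e = 0`** on `S = E₀ × E₀`. -/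
theorem eLetter_cup_eLetter (v : complexBetti E₀.X 1) : cupProduct d1122 (eLetter ψ₀ v) (eLetter ψ₀ v) = 0 := by
  rw [eLetter, cupMap_interchange _ _ one_add_one_eq_two_mul_one one_add_one_eq_two_mul_one d1122 one_add_one_eq_two_mul_one
      one_add_one_eq_two_mul_one d1122,
    xPlus_cup_xPlus, map_zero, map_zero, LinearMap.zero_apply, smul_zero]

/-- **`ē ∪ ē = 0`.** -/
theorem ebarLetter_cup_ebarLetter (v : complexBetti E₀.X 1) :
    cupProduct d1122 (ebarLetter ψ₀ v) (ebarLetter ψ₀ v) = 0 := by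
  rw [ebarLetter, cupMap_interchange _ _ one_add_one_eq_two_mul_one one_add_one_eq_two_mul_one d1122 one_add_one_eq_two_mul_one
      one_add_one_eq_two_mul_one d1122,
    xMinus_cup_xMinus, map_zero, map_zero, LinearMap.zero_apply, smul_zero]

/-- the top class of the Weil surface carried by the letters: `ss := pr₁^*(x⁺x⁻) ∪ pr₂^*(x⁺x⁻) ∈ H⁴(S(ℂ); ℂ)`. -/
def ss (ψ₀ : E₀ ⟶ E₀) (v : complexBetti E₀.X 1) : complexBetti (weilSurf E₀).X (2 * 2) :=
  cupProduct d1122 (complexBetti.map (AbelianVariety.fst E₀ E₀).hom.hom.hom (2 * 1) (xx ψ₀ v))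
    (complexBetti.map (AbelianVariety.snd E₀ E₀).hom.hom.hom (2 * 1) (xx ψ₀ v))

/-- **`e ∪ ē = ss`** (`= pr₁^*(x⁺∪x⁻) ∪ pr₂^*(x⁻∪x⁺)·(−1) = pr₁^*(x⁺x⁻) ∪ pr₂^*(x⁺x⁻)`). -/
theorem eLetter_cup_ebarLetter (v : complexBetti E₀.X 1) :
    cupProduct d1122 (eLetter ψ₀ v) (ebarLetter ψ₀ v) = ss ψ₀ v := by
  rw [eLetter, ebarLetter, cupMap_interchange _ _ one_add_one_eq_two_mul_one one_add_one_eq_two_mul_one d1122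
      one_add_one_eq_two_mul_one one_add_one_eq_two_mul_one d1122,
    xMinus_cup_xPlus, map_neg, map_neg, smul_neg, pow_one, neg_smul, one_smul, neg_neg, ss, xx]

/-- `ē ∪ e = ss` as well (even degrees commute). -/
theorem ebarLetter_cup_eLetter (v : complexBetti E₀.X 1) :
    cupProduct d1122 (ebarLetter ψ₀ v) (eLetter ψ₀ v) = ss ψ₀ v := by
  rw [cupProduct_gradedComm_holds ℂ (ComplexPoints (weilSurf E₀).X) d1122 d1122 (ebarLetter ψ₀ v) (eLetter ψ₀ v),
    eLetter_cup_ebarLetter]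
  norm_num

end Letters

/-! ## §39.3 The Künneth square lemma for `cross` and the tower squares `ee² = eee² = eeee² = 0` (and bars) -/

section TowerSquares

variable {E₀ : AbelianVariety ℂ} {B : AbelianVariety ℂ} {ψ₀ : E₀ ⟶ E₀}

/-- **the KÜNNETH-SQUARE ∕ INTERCHANGE LEMMA FOR `cross`** (g38 LEFTOVER (i)): `cross b c ∪ cross b' c' =
pr₁^*(b ∪ b') ∪ pr₂^*(c ∪ c')` on `B × S` — no sign, all degrees even. [cite: HatcherAT2002, §3.2 Thm. 3.16 and Prop. 3.10] -/
theorem cross_cup_cross {n n' N M : ℕ} (hN : 2 * (n + 1) + 2 * (n' + 1) = N) (hM : 2 * n + 2 * n' = M)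
    (hMN : M + 2 * 2 = N) (b : complexBetti B.X (2 * n)) (b' : complexBetti B.X (2 * n'))
    (c c' : complexBetti (weilSurf E₀).X (2 * 1)) :
    cupProduct hN (cross b c) (cross b' c') =
      cupProduct hMN (complexBetti.map (AbelianVariety.fst B (weilSurf E₀)).hom.hom.hom M (cupProduct hM b b'))
        (complexBetti.map (AbelianVariety.snd B (weilSurf E₀)).hom.hom.hom (2 * 2) (cupProduct d1122 c c')) :=
  cupMap_interchange_of_even _ _ (two_mul_add_two_mul n 1) (two_mul_add_two_mul n' 1) hN hM d1122 hMN
    ((even_two_mul 1).mul_right (2 * n')) b c b' c'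

theorem d2244 : 2 * 2 + 2 * 2 = 2 * 4 := rfl
theorem d3366 : 2 * 3 + 2 * 3 = 2 * 6 := rfl
theorem d4488 : 2 * 4 + 2 * 4 = 2 * 8 := rfl
theorem d4226 : 2 * 4 + 2 * 2 = 2 * 6 := rfl
theorem d6228 : 2 * 6 + 2 * 2 = 2 * 8 := rfl

variable (ψ₀)

/-- **`ee ∪ ee = 0`** in `H⁸(S²)`. -/
theorem eTwo_cup_eTwo (h : 2 * 2 + 2 * 2 = 2 * 4) (v : complexBetti E₀.X 1) : cupProduct h (eTwo ψ₀ v) (eTwo ψ₀ v) = 0 := by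
  rw [eTwo, cross_cup_cross h d1122 d2244]
  simp only [eLetter_cup_eLetter, map_zero]

/-- **`ēē ∪ ēē = 0`.** -/
theorem ebarTwo_cup_ebarTwo (h : 2 * 2 + 2 * 2 = 2 * 4) (v : complexBetti E₀.X 1) :
    cupProduct h (ebarTwo ψ₀ v) (ebarTwo ψ₀ v) = 0 := by
  rw [ebarTwo, cross_cup_cross h d1122 d2244]
  simp only [ebarLetter_cup_ebarLetter, map_zero]

/-- **`eee ∪ eee = 0`** in `H¹²(S³)`. -/
theorem eThree_cup_eThree (h : 2 * 3 + 2 * 3 = 2 * 6) (v : complexBetti E₀.X 1) :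
    cupProduct h (eThree ψ₀ v) (eThree ψ₀ v) = 0 := by
  rw [eThree, cross_cup_cross h d2244 d4226]
  simp only [eTwo_cup_eTwo, map_zero, LinearMap.zero_apply]

/-- **`ēēē ∪ ēēē = 0`.** -/
theorem ebarThree_cup_ebarThree (h : 2 * 3 + 2 * 3 = 2 * 6) (v : complexBetti E₀.X 1) :
    cupProduct h (ebarThree ψ₀ v) (ebarThree ψ₀ v) = 0 := by
  rw [ebarThree, cross_cup_cross h d2244 d4226]
  simp only [ebarTwo_cup_ebarTwo, map_zero, LinearMap.zero_apply]

/-- **`eeee ∪ eeee = 0` in `H¹⁶(S⁴(ℂ); ℂ)`** — the first of the two squares v38 `frameGram_normalisedFrame_iff` had to carry as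
hypotheses (g38 §4 LEFTOVER (i)), now a theorem: `x⁺ ∪ x⁺ = 0` on the curve, pushed up the nested tower by `cross_cup_cross`.
[cite: HatcherAT2002, §3.2 Thm. 3.16] [cite: vanGeemen1994HodgeAV, proof of Thm. 6.12] -/
theorem eeee_cup_eeee (h : 2 * 4 + 2 * 4 = 2 * 8) (v : complexBetti E₀.X 1) : cupProduct h (eeee ψ₀ v) (eeee ψ₀ v) = 0 := by
  rw [eeee, cross_cup_cross h d3366 d6228]
  simp only [eThree_cup_eThree, map_zero, LinearMap.zero_apply]

/-- **`ēēēē ∪ ēēēē = 0`** — the second square. -/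
theorem eeeeBar_cup_eeeeBar (h : 2 * 4 + 2 * 4 = 2 * 8) (v : complexBetti E₀.X 1) :
    cupProduct h (eeeeBar ψ₀ v) (eeeeBar ψ₀ v) = 0 := by
  rw [eeeeBar, cross_cup_cross h d3366 d6228]
  simp only [ebarThree_cup_ebarThree, map_zero, LinearMap.zero_apply]

/-- `ēēēē ∪ eeee = eeee ∪ ēēēē` (degrees `8 · 8` even). [cite: HatcherAT2002, §3.2 Thm. 3.11] -/
theorem eeeeBar_cup_eeee (h : 2 * 4 + 2 * 4 = 2 * 8) (v : complexBetti E₀.X 1) :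
    cupProduct h (eeeeBar ψ₀ v) (eeee ψ₀ v) = cupProduct h (eeee ψ₀ v) (eeeeBar ψ₀ v) := by
  rw [cupProduct_gradedComm_holds ℂ (ComplexPoints (pad4Anchor E₀).X) h h (eeeeBar ψ₀ v) (eeee ψ₀ v),
    Even.neg_one_pow (by decide), one_smul]

/-- **THE ONE SURVIVING TOP CLASS `ω := eeee ∪ ēēēē ∈ H¹⁶(S⁴(ℂ); ℂ)`** of the frame of record. -/
def omega (v : complexBetti E₀.X 1) : complexBetti (pad4Anchor E₀).X (2 * 8) := cupProduct d4488 (eeee ψ₀ v) (eeeeBar ψ₀ v)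

theorem cupProduct_eeee_eeeeBar (h : 2 * 4 + 2 * 4 = 2 * 8) (v : complexBetti E₀.X 1) :
    cupProduct h (eeee ψ₀ v) (eeeeBar ψ₀ v) = omega ψ₀ v := rfl

/-- **bilinear expansion on the `{eeee, ēēēē}` plane**: `(a·eeee + b·ēēēē) ∪ (c·eeee + d·ēēēē) = (ad + bc)·ω`. -/
theorem cup_planeComb (h : 2 * 4 + 2 * 4 = 2 * 8) (a b c d : ℂ) (v : complexBetti E₀.X 1) :
    cupProduct h (a • eeee ψ₀ v + b • eeeeBar ψ₀ v) (c • eeee ψ₀ v + d • eeeeBar ψ₀ v) = (a * d + b * c) • omega ψ₀ v := by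
  simp only [map_add, map_smul, LinearMap.add_apply, LinearMap.smul_apply, eeee_cup_eeee, eeeeBar_cup_eeeeBar,
    eeeeBar_cup_eeee, cupProduct_eeee_eeeeBar, smul_zero, zero_add, add_zero]
  module

end TowerSquares

/-! ## §39.4 The Gram form of the frame of record is SCALAR: `r₁² = r₂² = 2ω`, `r₁r₂ = 0`, `w_μ ∪ w_μ' = (μμ̄' + μ̄μ')·ω` -/

section GramOfRecord

variable {E₀ : AbelianVariety ℂ} {ψ₀ : E₀ ⟶ E₀}
variable (hE : E₀.dim = 1) (hψ : ψ₀ ≫ ψ₀ = -(1 • 𝟙 E₀)) {v : complexBetti E₀.X 1} (hv : IsRationalClass v) (hv0 : v ≠ 0)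

/-- `r₁ ∪ r₁ = 2·ω`. -/
theorem rOne_cup_rOne (h : 2 * 4 + 2 * 4 = 2 * 8) :
    cupProduct h (normalisedFrame hE hψ hv hv0).rOne (normalisedFrame hE hψ hv hv0).rOne = (2 : ℂ) • omega ψ₀ v := by
  have h1 : eeee ψ₀ v + eeeeBar ψ₀ v = (1 : ℂ) • eeee ψ₀ v + (1 : ℂ) • eeeeBar ψ₀ v := by rw [one_smul, one_smul]
  rw [normalisedFrame_rOne, h1, cup_planeComb]
  norm_num

/-- `r₂ ∪ r₂ = 2·ω`. -/
theorem rTwo_cup_rTwo (h : 2 * 4 + 2 * 4 = 2 * 8) :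
    cupProduct h (normalisedFrame hE hψ hv hv0).rTwo (normalisedFrame hE hψ hv hv0).rTwo = (2 : ℂ) • omega ψ₀ v := by
  have h1 : Complex.I • (eeee ψ₀ v - eeeeBar ψ₀ v) = Complex.I • eeee ψ₀ v + (-Complex.I) • eeeeBar ψ₀ v := by module
  have hc : Complex.I * -Complex.I + -Complex.I * Complex.I = 2 := by
    rw [mul_neg, neg_mul, Complex.I_mul_I]; norm_num
  rw [normalisedFrame_rTwo, h1, cup_planeComb, hc]

/-- `r₁ ∪ r₂ = 0`. -/
theorem rOne_cup_rTwo (h : 2 * 4 + 2 * 4 = 2 * 8) :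
    cupProduct h (normalisedFrame hE hψ hv hv0).rOne (normalisedFrame hE hψ hv hv0).rTwo = 0 := by
  have h1 : eeee ψ₀ v + eeeeBar ψ₀ v = (1 : ℂ) • eeee ψ₀ v + (1 : ℂ) • eeeeBar ψ₀ v := by rw [one_smul, one_smul]
  have h2 : Complex.I • (eeee ψ₀ v - eeeeBar ψ₀ v) = Complex.I • eeee ψ₀ v + (-Complex.I) • eeeeBar ψ₀ v := by module
  rw [normalisedFrame_rOne, normalisedFrame_rTwo, h1, h2, cup_planeComb, show (1 : ℂ) * -Complex.I + 1 * Complex.I = 0 by ring,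
    zero_smul]

/-- `r₂ ∪ r₁ = 0`. -/
theorem rTwo_cup_rOne (h : 2 * 4 + 2 * 4 = 2 * 8) :
    cupProduct h (normalisedFrame hE hψ hv hv0).rTwo (normalisedFrame hE hψ hv hv0).rOne = 0 := by
  have h1 : eeee ψ₀ v + eeeeBar ψ₀ v = (1 : ℂ) • eeee ψ₀ v + (1 : ℂ) • eeeeBar ψ₀ v := by rw [one_smul, one_smul]
  have h2 : Complex.I • (eeee ψ₀ v - eeeeBar ψ₀ v) = Complex.I • eeee ψ₀ v + (-Complex.I) • eeeeBar ψ₀ v := by module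
  rw [normalisedFrame_rOne, normalisedFrame_rTwo, h1, h2, cup_planeComb, show Complex.I * (1 : ℂ) + -Complex.I * 1 = 0 by ring,
    zero_smul]

/-- **`w_μ ∪ w_μ' = (μ·μ̄' + μ̄·μ')·ω`** — the Gram form of the frame of record in the `ℤ[i]`-coordinate of the designs (C0's `mu`):
the trace form `Tr_{ℚ(i)∕ℚ}(μ μ̄')` times ONE class. -/
theorem wOf_cup_wOf (h : 2 * 4 + 2 * 4 = 2 * 8) (μ μ' : GaussianInt) :
    cupProduct h ((normalisedFrame hE hψ hv hv0).wOf μ) ((normalisedFrame hE hψ hv hv0).wOf μ') =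
      (GaussianInt.toComplex μ * GaussianInt.toComplex (star μ') +
        GaussianInt.toComplex (star μ) * GaussianInt.toComplex μ') • omega ψ₀ v := by
  rw [normalisedFrame_wOf, normalisedFrame_wOf, cup_planeComb]

/-- `μ·μ̄ = N(μ)` in `ℂ`. -/
theorem toComplex_mul_toComplex_star (μ : GaussianInt) :
    GaussianInt.toComplex μ * GaussianInt.toComplex (star μ) = ((μ.norm : ℤ) : ℂ) := by
  rw [GaussianInt.toComplex_star, Complex.mul_conj, GaussianInt.intCast_complex_norm]

/-- **`w_μ ∪ w_μ = 2·N(μ)·ω`** (MEMO-06's `∫ w_μ² = 2|μ|²`, as classes: the unit is `ω`, not yet a number). -/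
theorem wOf_cup_self (h : 2 * 4 + 2 * 4 = 2 * 8) (μ : GaussianInt) :
    cupProduct h ((normalisedFrame hE hψ hv hv0).wOf μ) ((normalisedFrame hE hψ hv hv0).wOf μ) =
      ((2 * μ.norm : ℤ) : ℂ) • omega ψ₀ v := by
  rw [wOf_cup_wOf, mul_comm (GaussianInt.toComplex (star μ)), toComplex_mul_toComplex_star]
  congr 1
  push_cast
  ring

end GramOfRecord

/-! ## §39.5 `FrameGram` of the frame of record = ONE top-degree number -/

section OneNumber

open NewtonClosure

variable {E₀ : AbelianVariety ℂ} {ψ₀ : E₀ ⟶ E₀}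
variable (hE : E₀.dim = 1) (hψ : ψ₀ ≫ ψ₀ = -(1 • 𝟙 E₀)) {v : complexBetti E₀.X 1} (hv : IsRationalClass v) (hv0 : v ≠ 0)

/-- **v23's `FrameGram` for the frame of record is ONE EQUATION between top classes: `2·8!·ω = γ·h⁸`** (no `μ` left: the
`ℤ[i]`-dependence is exactly `N(μ)` on both sides). v38 `frameGram_normalisedFrame_iff` minus its two square hypotheses. -/
theorem frameGram_normalisedFrame_iff (h : complexBetti (pad4Anchor E₀).X 2) (γ : ℚ) :
    FrameGram (normalisedFrame hE hψ hv hv0) h γ ↔ (80640 : ℂ) • omega ψ₀ v = ((γ : ℚ) : ℂ) • cupPowTwo h 8 := by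
  constructor
  · intro hG
    have h1 := hG 1
    rw [wOf_cup_self, Zsqrtd.norm_one, smul_smul] at h1
    push_cast at h1
    rw [show (40320 : ℂ) * 2 = 80640 by norm_num, mul_one] at h1
    exact h1
  · intro hω μ
    rw [wOf_cup_self, smul_smul]
    push_cast
    rw [show (40320 : ℂ) * (2 * (μ.norm : ℂ)) = (μ.norm : ℂ) * 80640 by ring, ← smul_smul, hω, smul_smul, mul_comm]

include hE in
/-- … and `2·8!·ω` IS a multiple of `h⁸` whenever `h⁸ ≠ 0` (`H¹⁶(S⁴) = ℂ·h⁸`, v12): the frame of record always HAS a Gram constant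
`c ∈ ℂ`; `FrameGram … γ` says `c = γ ∈ ℚ`. -/
theorem exists_frameGram_constant (h : complexBetti (pad4Anchor E₀).X 2) (h8 : cupPowTwo h 8 ≠ 0) :
    ∃ c : ℂ, (80640 : ℂ) • omega ψ₀ v = c • cupPowTwo h 8 :=
  exists_eq_smul_hPow8 hE h8 _

/-- **`FrameGram` ⟺ `γ = 2·8!·deg_h(ω)`** in v12's `h`-degree coordinate (`deg_h h⁸ = 1`). -/
theorem frameGram_normalisedFrame_iff_hDegree (h : complexBetti (pad4Anchor E₀).X 2) (h8 : cupPowTwo h 8 ≠ 0) (γ : ℚ) :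
    FrameGram (normalisedFrame hE hψ hv hv0) h γ ↔ ((γ : ℚ) : ℂ) = 80640 * hDegree hE h h8 (omega ψ₀ v) := by
  rw [frameGram_normalisedFrame_iff]
  conv_lhs => rw [eq_hDegree_smul hE h8 (omega ψ₀ v), smul_smul]
  rw [(smul_left_injective ℂ h8).eq_iff, eq_comm]

/-- MEMO-06's value `γ = 2` ⟺ `8!·ω = h⁸`, i.e. `deg_h(eeee ∪ ēēēē) = 1∕8!`. -/
theorem frameGram_two_iff (h : complexBetti (pad4Anchor E₀).X 2) :
    FrameGram (normalisedFrame hE hψ hv hv0) h 2 ↔ (40320 : ℂ) • omega ψ₀ v = cupPowTwo h 8 := by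
  rw [frameGram_normalisedFrame_iff]
  push_cast
  constructor
  · intro h2
    have := congrArg (fun x => (2⁻¹ : ℂ) • x) h2
    simp only [smul_smul] at this
    norm_num at this
    exact this
  · intro h1
    rw [← h1, smul_smul]
    norm_num

end OneNumber

/-! ## §39.6 `ω = eeee ∪ ēēēē ≠ 0` unconditionally (Poincaré duality on `E₀`, Künneth up the tower) ⇒ `γ ≠ 0` -/

section Nonvanishing

variable {E₀ : AbelianVariety ℂ} {ψ₀ : E₀ ⟶ E₀}

/-- **`v ∪ ψ₀^*v ≠ 0` in `H²(E₀(ℂ); ℂ)`** for a rational `v ≠ 0`: `{v, ψ₀^*v}` is a basis of `H¹` (`linearIndependent_pair_map_one`,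
`finrank H¹ = 2`), `v ∪ v = 0`, and the cup pairing of the closed surface `E₀(ℂ)` is perfect (`eq_zero_of_forall_cupPairing_eq_zero`).
[cite: HatcherAT2002, §3.3 Prop. 3.38] -/
theorem cup_map_one_ne_zero (hE : E₀.dim = 1) (hψ : ψ₀ ≫ ψ₀ = -(1 • 𝟙 E₀)) {v : complexBetti E₀.X 1}
    (hv : IsRationalClass v) (hv0 : v ≠ 0) :
    cupProduct one_add_one_eq_two_mul_one v (complexBetti.map ψ₀.hom.hom.hom 1 v) ≠ 0 := by
  set w : complexBetti E₀.X 1 := complexBetti.map ψ₀.hom.hom.hom 1 v with hw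
  intro h0
  have hli : LinearIndependent ℂ ![v, w] := linearIndependent_pair_map_one one_pos hψ hv hv0
  have hspan : Submodule.span ℂ (Set.range ![v, w]) = ⊤ :=
    hli.span_eq_top_of_card_eq_finrank (by rw [Fintype.card_fin, AbelianVariety.finrank_complexBetti_one, hE])
  have hvv : cupProduct one_add_one_eq_two_mul_one v v = 0 := cup_self_deg_one v
  refine hv0 (eq_zero_of_forall_cupPairing_eq_zero
    (fun _ _ hX ↦ Classical.choice (Motives.ComplexPoints.isOrientableOver ℂ hX)) (isSmoothProjective_of_dim_eq' hE)
    one_add_one_eq_two_mul_one fun b ↦ ?_)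
  have hb : b ∈ Submodule.span ℂ (Set.range ![v, w]) := by rw [hspan]; exact Submodule.mem_top
  rw [Matrix.range_cons_cons_empty, Submodule.mem_span_pair] at hb
  obtain ⟨s, t, rfl⟩ := hb
  simp only [cupPairing_apply, map_add, map_smul, hvv, h0, smul_zero, add_zero, map_zero, LinearMap.zero_apply]

/-- **`x⁺ ∪ x⁻ ≠ 0`.** -/
theorem xx_ne_zero (hE : E₀.dim = 1) (hψ : ψ₀ ≫ ψ₀ = -(1 • 𝟙 E₀)) {v : complexBetti E₀.X 1} (hv : IsRationalClass v)
    (hv0 : v ≠ 0) : xx ψ₀ v ≠ 0 := by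
  rw [xx_eq]
  exact smul_ne_zero (mul_ne_zero two_ne_zero Complex.I_ne_zero) (cup_map_one_ne_zero hE hψ hv hv0)

/-- **`ss ≠ 0` in `H⁴(S(ℂ); ℂ)`** (Künneth injectivity on `E₀ × E₀`). [cite: HatcherAT2002, Thm. 3.16] -/
theorem ss_ne_zero (hE : E₀.dim = 1) (hψ : ψ₀ ≫ ψ₀ = -(1 • 𝟙 E₀)) {v : complexBetti E₀.X 1} (hv : IsRationalClass v)
    (hv0 : v ≠ 0) : ss ψ₀ v ≠ 0 :=
  cupProduct_map_fst_map_snd_ne_zero_of_add_eq (isSmoothProjective_of_dim_eq' hE) (isSmoothProjective_of_dim_eq' hE) d1122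
    (by omega) (xx_ne_zero hE hψ hv hv0) (xx_ne_zero hE hψ hv hv0)

variable (ψ₀)

/-- `ee ∪ ēē = pr₁^*ss ∪ pr₂^*ss` on `S²`. -/
theorem eTwo_cup_ebarTwo (h : 2 * 2 + 2 * 2 = 2 * 4) (v : complexBetti E₀.X 1) :
    cupProduct h (eTwo ψ₀ v) (ebarTwo ψ₀ v) =
      cupProduct d2244 (complexBetti.map (AbelianVariety.fst (weilSurf E₀) (weilSurf E₀)).hom.hom.hom (2 * 2) (ss ψ₀ v))
        (complexBetti.map (AbelianVariety.snd (weilSurf E₀) (weilSurf E₀)).hom.hom.hom (2 * 2) (ss ψ₀ v)) := by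
  rw [eTwo, ebarTwo, cross_cup_cross h d1122 d2244, eLetter_cup_ebarLetter]

/-- `eee ∪ ēēē = pr₁^*(ee ∪ ēē) ∪ pr₂^*ss` on `S³`. -/
theorem eThree_cup_ebarThree (h : 2 * 3 + 2 * 3 = 2 * 6) (v : complexBetti E₀.X 1) :
    cupProduct h (eThree ψ₀ v) (ebarThree ψ₀ v) =
      cupProduct d4226 (complexBetti.map (AbelianVariety.fst (pad2Anchor E₀) (weilSurf E₀)).hom.hom.hom (2 * 4)
          (cupProduct d2244 (eTwo ψ₀ v) (ebarTwo ψ₀ v)))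
        (complexBetti.map (AbelianVariety.snd (pad2Anchor E₀) (weilSurf E₀)).hom.hom.hom (2 * 2) (ss ψ₀ v)) := by
  rw [eThree, ebarThree, cross_cup_cross h d2244 d4226, eLetter_cup_ebarLetter]

/-- `ω = eeee ∪ ēēēē = pr₁^*(eee ∪ ēēē) ∪ pr₂^*ss` on `S⁴`. -/
theorem omega_eq (v : complexBetti E₀.X 1) :
    omega ψ₀ v =
      cupProduct d6228 (complexBetti.map (AbelianVariety.fst (pad3Anchor E₀) (weilSurf E₀)).hom.hom.hom (2 * 6)
          (cupProduct d3366 (eThree ψ₀ v) (ebarThree ψ₀ v)))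
        (complexBetti.map (AbelianVariety.snd (pad3Anchor E₀) (weilSurf E₀)).hom.hom.hom (2 * 2) (ss ψ₀ v)) := by
  rw [omega, eeee, eeeeBar, cross_cup_cross d4488 d3366 d6228, eLetter_cup_ebarLetter]

variable {ψ₀}
variable (hE : E₀.dim = 1) (hψ : ψ₀ ≫ ψ₀ = -(1 • 𝟙 E₀)) {v : complexBetti E₀.X 1} (hv : IsRationalClass v) (hv0 : v ≠ 0)
include hE hψ hv hv0

theorem eTwo_cup_ebarTwo_ne_zero : cupProduct d2244 (eTwo ψ₀ v) (ebarTwo ψ₀ v) ≠ 0 := by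
  rw [eTwo_cup_ebarTwo]
  exact cupProduct_map_fst_map_snd_ne_zero_of_add_eq (isSmoothProjective_of_dim_eq' (weilSurf_dim hE))
    (isSmoothProjective_of_dim_eq' (weilSurf_dim hE)) d2244 (by omega) (ss_ne_zero hE hψ hv hv0) (ss_ne_zero hE hψ hv hv0)

theorem eThree_cup_ebarThree_ne_zero : cupProduct d3366 (eThree ψ₀ v) (ebarThree ψ₀ v) ≠ 0 := by
  rw [eThree_cup_ebarThree]
  exact cupProduct_map_fst_map_snd_ne_zero_of_add_eq
    (isSmoothProjective_of_dim_eq' (dim_prod_eq_two_mul (weilSurf_dim hE) (weilSurf_dim hE)))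
    (isSmoothProjective_of_dim_eq' (weilSurf_dim hE)) d4226 (by omega) (eTwo_cup_ebarTwo_ne_zero hE hψ hv hv0)
    (ss_ne_zero hE hψ hv hv0)

/-- **`ω = eeee ∪ ēēēē ≠ 0` in `H¹⁶(S⁴(ℂ); ℂ)` — UNCONDITIONALLY** (no kit, no polarisation, no `WeilAnisotropic`): the Gram
form of the frame of record is a NON-ZERO scalar form. -/
theorem omega_ne_zero : omega ψ₀ v ≠ 0 := by
  rw [omega_eq]
  exact cupProduct_map_fst_map_snd_ne_zero_of_add_eq
    (isSmoothProjective_of_dim_eq' (dim_prod_eq_two_mul (dim_prod_eq_two_mul (weilSurf_dim hE) (weilSurf_dim hE))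
      (weilSurf_dim hE)))
    (isSmoothProjective_of_dim_eq' (weilSurf_dim hE)) d6228 (by omega) (eThree_cup_ebarThree_ne_zero hE hψ hv hv0)
    (ss_ne_zero hE hψ hv hv0)

/-- hence `r₁ ∪ r₁ ≠ 0`, `w_μ ∪ w_μ ≠ 0` for `μ ≠ 0` … -/
theorem wOf_cup_self_ne_zero (h : 2 * 4 + 2 * 4 = 2 * 8) {μ : GaussianInt} (hμ : μ ≠ 0) :
    cupProduct h ((normalisedFrame hE hψ hv hv0).wOf μ) ((normalisedFrame hE hψ hv hv0).wOf μ) ≠ 0 := by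
  rw [wOf_cup_self]
  refine smul_ne_zero ?_ (omega_ne_zero hE hψ hv hv0)
  exact_mod_cast mul_ne_zero two_ne_zero (GaussianInt.norm_pos.2 hμ).ne'

open NewtonClosure in
/-- **… and a `FrameGram` constant of the frame of record is never `0`, and forces `h⁸ ≠ 0`.** -/
theorem frameGram_gamma_ne_zero {h : complexBetti (pad4Anchor E₀).X 2} {γ : ℚ}
    (hG : FrameGram (normalisedFrame hE hψ hv hv0) h γ) : γ ≠ 0 ∧ cupPowTwo h 8 ≠ 0 := by
  rw [frameGram_normalisedFrame_iff] at hG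
  have hne : ((γ : ℚ) : ℂ) • cupPowTwo h 8 ≠ 0 := by
    rw [← hG]; exact smul_ne_zero (by norm_num) (omega_ne_zero hE hψ hv hv0)
  exact ⟨fun h0 ↦ hne (by rw [h0, Rat.cast_zero, zero_smul]), fun h0 ↦ hne (by rw [h0, smul_zero])⟩

end Nonvanishing

/-! ## §39.7 The one number is `v`-RELATIVE: `ω(v') = r⁸·ω(v)`, `γ(v') = r⁸·γ(v)` (v7.1 FLAG (1) made quantitative) -/

section Scale

variable {E₀ : AbelianVariety ℂ} {ψ₀ : E₀ ⟶ E₀}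

/-- `e' = r·e`, `ē' = r·ē ⟹ ω' = r⁸·ω`. -/
theorem omega_eq_smul_of {v v' : complexBetti E₀.X 1} {r : ℂ} (he : eLetter ψ₀ v' = r • eLetter ψ₀ v)
    (hb : ebarLetter ψ₀ v' = r • ebarLetter ψ₀ v) : omega ψ₀ v' = r ^ 8 • omega ψ₀ v := by
  simp only [omega, eeee_eq_smul_of he, eeeeBar_eq_smul_of hb, map_smul, LinearMap.smul_apply, smul_smul, ← pow_add,
    Nat.reduceAdd]

/-- **two rational generators `v, v' ≠ 0` of `H¹(E₀)` give `ω(v') = r⁸·ω(v)` for a real `r > 0`.** -/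
theorem exists_omega_eq_smul (hE : E₀.dim = 1) (hψ : ψ₀ ≫ ψ₀ = -(1 • 𝟙 E₀)) {v v' : complexBetti E₀.X 1}
    (hv : IsRationalClass v) (hv0 : v ≠ 0) (hv' : IsRationalClass v') (hv0' : v' ≠ 0) :
    ∃ r : ℝ, 0 < r ∧ omega ψ₀ v' = ((r : ℂ) ^ 8) • omega ψ₀ v := by
  obtain ⟨r, hr, he, hb, -, -⟩ := exists_letters_eq_smul hE hψ hv hv0 hv' hv0'
  exact ⟨r, hr, omega_eq_smul_of he hb⟩

open NewtonClosure in
/-- **the `FrameGram` constant RESCALES by `r⁸`** between the frames of record of `v` and `v'`: it is an invariant of the pair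
(anchor, `v`), not of the anchor — MEMO-06's `γ = 2` presupposes a normalisation of `v` against `h` (FLAG, v39 §3). -/
theorem frameGram_rescale (hE : E₀.dim = 1) (hψ : ψ₀ ≫ ψ₀ = -(1 • 𝟙 E₀)) {v v' : complexBetti E₀.X 1}
    (hv : IsRationalClass v) (hv0 : v ≠ 0) (hv' : IsRationalClass v') (hv0' : v' ≠ 0)
    {h : complexBetti (pad4Anchor E₀).X 2} {γ : ℚ} (hG : FrameGram (normalisedFrame hE hψ hv hv0) h γ) {r : ℝ}
    (hr : omega ψ₀ v' = ((r : ℂ) ^ 8) • omega ψ₀ v) (γ' : ℚ) :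
    FrameGram (normalisedFrame hE hψ hv' hv0') h γ' ↔ ((γ' : ℚ) : ℂ) = (r : ℂ) ^ 8 * ((γ : ℚ) : ℂ) := by
  have h8 := (frameGram_gamma_ne_zero hE hψ hv hv0 hG).2
  rw [frameGram_normalisedFrame_iff] at hG ⊢
  rw [hr, smul_comm, hG, smul_smul, (smul_left_injective ℂ h8).eq_iff, eq_comm]

end Scale

end Summit.HodgeConjecture.HodgeConjecture.Cruxes.BlochSeedDiscOne.SeedChecker.KunnethSquare

end
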